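import Summits.SmoothPoincare4.SmoothPoincare4.Theorems.InformationMetricHadamardConvexEndRecognitionExp

/-!
# Rays from an interior point of a compact convex body in a Cartan–Hadamard manifold

Helper file for route InformationMetricHadamard, items `ConvexEndRecognition`
(stmt-SmoothPoincare4-6017) and `HadamardConvexBoundarySphere` (stmt-SmoothPoincare4-6016).
`M` is simply connected, geodesically complete, `Rm(X,Y,Y,X) ≤ 0`; `K ⊆ M` is compact and convex
in the betweenness sense; `o ∈ interior K`.

* `exists_pos_expMap_smul_mem_frontier`: every ray `s ↦ exp_o (s θ)`, `θ ≠ 0`, meets `frontier K`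
  at some `s > 0` (the last parameter in `K`).
* `eq_of_expMap_smul_mem_frontier`: it meets `frontier K` only once (an earlier frontier point on
  the ray would lie in the open cone over an interior ball, `expMap_smul_mem_interior`).
* `not_mem_range_mfderiv_of_expMap_mem_interior`: a hypersurface running in `K \ interior K` is
  transverse to every geodesic chord into `interior K` (first-order version of the same cone
  argument, in the normal chart `exp_p⁻¹`).

Everything is proved; no definitions, no named facts.

References: J. M. Lee, *Introduction to Riemannian Manifolds* (2018), Ch. 12 (Thm. 12.8,
Prop. 12.9); P. Eberlein, B. O'Neill, *Visibility manifolds*, Pacific J. Math. 46 (1973), §1.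
-/

noncomputable section

-- the registered namespace `Summit.SmoothPoincare4.SmoothPoincare4.Theorems` repeats a component
set_option linter.dupNamespace false

open Bundle Set Filter Function TopologicalSpace Bornology
open scoped Manifold ContDiff Topology ENNReal Pointwise

namespace Summit.SmoothPoincare4.SmoothPoincare4.Theorems.HadamardConvex

open Literature.Geometry.Lorentzian Literature.Geometry.Lorentzian.PseudoRiemannianMetric
  Literature.Geometry.Riemannian Literature.Geometry.Riemannian.SimpleAH

set_option maxSynthPendingDepth 3

variable {E : Type*} [NormedAddCommGroup E] [NormedSpace ℝ E] {H : Type*} [TopologicalSpace H]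
  {I : ModelWithCorners ℝ E H} {M : Type*} [TopologicalSpace M] [ChartedSpace H M]
  [IsManifold I ∞ M] [FiniteDimensional ℝ E] [CompleteSpace E] [T2Space M] [I.Boundaryless]
  [SimplyConnectedSpace M] [LocallyPathConnectedSpace M]
  {g : PseudoRiemannianMetric I ∞ E (TangentSpace I : M → Type _)} [g.HasLeviCivita]
  [CovariantDerivative.ContMDiffCovariantDerivative g.leviCivita 1]
  [CovariantDerivative.ContMDiffCovariantDerivative g.leviCivita ∞]

/-- **Every ray from an interior point of a compact set leaves it through the frontier**: for
`K` compact, `o ∈ interior K` and `θ ≠ 0` there is `s > 0` with `exp_o (s θ) ∈ frontier K` — the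
supremum of the compact set `{s ≥ 0 | exp_o (s θ) ∈ K}` (bounded since `exp_o⁻¹ K` is compact in
`T_oM`, `exp_o` being a diffeomorphism). [cite: Lee2018, Thm. 12.8] -/
theorem exists_pos_expMap_smul_mem_frontier (hg : g.IsRiemannian)
    (hc : IsGeodesicallyComplete g.leviCivita)
    (hsec : ∀ (x : M) (X Y : TangentSpace I x), g.curvatureForm g.leviCivita x X Y Y X ≤ 0)
    {K : Set M} (hKc : IsCompact K) {o : M} (ho : o ∈ interior K) {θ : E} (hθ : θ ≠ 0) :
    ∃ s : ℝ, 0 < s ∧ expMap g.leviCivita o (show TangentSpace I o from s • θ) ∈ frontier K := by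
  obtain ⟨Φ, hΦ⟩ := exists_expDiffeomorph hg hc hsec o
  set F : E → M := fun u ↦ expMap g.leviCivita o (show TangentSpace I o from u) with hFdef
  have hΦF : ∀ u, Φ u = F u := fun u ↦ congr_fun hΦ u
  have hF0 : F 0 = o := expMap_zero (cov := g.leviCivita) o
  have hFc : Continuous F := hΦ ▸ Φ.continuous
  have hKcl : IsClosed K := hKc.isClosed
  set S : Set ℝ := {s | 0 ≤ s ∧ F (s • θ) ∈ K} with hS
  have h0S : (0 : ℝ) ∈ S := ⟨le_rfl, by rw [zero_smul, hF0]; exact interior_subset ho⟩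
  -- `S` is bounded: `Φ⁻¹ K` is a compact, hence bounded, subset of `E`
  obtain ⟨R, hR⟩ := ((hKc.image Φ.symm.continuous).isBounded).exists_norm_le
  have hbdd : BddAbove S := by
    refine ⟨R / ‖θ‖, fun s hs ↦ ?_⟩
    have hmem : s • θ ∈ Φ.symm '' K := ⟨F (s • θ), hs.2, by rw [← hΦF]; exact Φ.symm_apply_apply _⟩
    have h1 : ‖s • θ‖ ≤ R := hR _ hmem
    rw [norm_smul, Real.norm_eq_abs, abs_of_nonneg hs.1] at h1
    rwa [le_div_iff₀ (norm_pos_iff.2 hθ)]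
  have hScl : IsClosed S := by
    have h1 : IsClosed {s : ℝ | F (s • θ) ∈ K} :=
      hKcl.preimage (hFc.comp (continuous_id.smul continuous_const))
    exact (isClosed_Ici (a := (0 : ℝ))).inter h1
  set s₀ := sSup S with hs₀
  have hs₀S : s₀ ∈ S := hScl.csSup_mem ⟨0, h0S⟩ hbdd
  -- beyond `s₀` the ray is outside `K`
  have hout : ∀ s, s₀ < s → F (s • θ) ∈ Kᶜ := by
    intro s hs hsK
    have : s ∈ S := ⟨hs₀S.1.trans hs.le, hsK⟩
    exact not_le.2 hs (le_csSup hbdd this)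
  have hT : Tendsto (fun s : ℝ ↦ F (s • θ)) (𝓝[>] s₀) (𝓝 (F (s₀ • θ))) :=
    ((hFc.comp (continuous_id.smul continuous_const)).tendsto s₀).mono_left nhdsWithin_le_nhds
  have hcl : F (s₀ • θ) ∈ closure Kᶜ :=
    mem_closure_of_tendsto hT (eventually_nhdsWithin_of_forall fun s hs ↦ hout s hs)
  have hfr : F (s₀ • θ) ∈ frontier K := by
    rw [frontier_eq_closure_inter_closure, hKcl.closure_eq]
    exact ⟨hs₀S.2, hcl⟩
  refine ⟨s₀, lt_of_le_of_ne hs₀S.1 ?_, hfr⟩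
  rintro h0
  rw [← h0, zero_smul, hF0] at hfr
  exact hfr.2 ho

/-- **A ray from an interior point of a convex body meets the frontier only once**: if
`exp_o (a θ)` and `exp_o (b θ)`, `0 < a ≤ b`, are both frontier points of the closed convex `K`
with `o ∈ interior K`, then `a = b` — otherwise `exp_o (a θ)` lies on the geodesic chord from the
point `exp_o (b θ) ∈ K` to the interior point `o`, hence in `interior K`
(`expMap_smul_mem_interior`, `expMap_neg_smul_velocity`). [cite: Lee2018, Prop. 12.9] -/
theorem eq_of_expMap_smul_mem_frontier (hg : g.IsRiemannian)
    (hc : IsGeodesicallyComplete g.leviCivita)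
    (hsec : ∀ (x : M) (X Y : TangentSpace I x), g.curvatureForm g.leviCivita x X Y Y X ≤ 0)
    {K : Set M} (hKcl : IsClosed K)
    (hK : ∀ a ∈ K, ∀ b ∈ K, ∀ m : M, g.edist hg a m + g.edist hg m b = g.edist hg a b → m ∈ K)
    {o : M} (ho : o ∈ interior K) {θ : E} {a b : ℝ} (ha : 0 < a) (hab : a ≤ b)
    (hfa : expMap g.leviCivita o (show TangentSpace I o from a • θ) ∈ frontier K)
    (hfb : expMap g.leviCivita o (show TangentSpace I o from b • θ) ∈ frontier K) : a = b := by
  by_contra hne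
  have hlt : a < b := lt_of_le_of_ne hab hne
  have hb : 0 < b := ha.trans hlt
  set γ := maximalGeodesic g.leviCivita o (show TangentSpace I o from θ) with hγ
  have hpb : expMap g.leviCivita o (show TangentSpace I o from b • θ) = γ b := expMap_smul hc o _ b
  -- the chord from `γ b` back to `o`
  have hwo : expMap g.leviCivita (γ b) (-(b • velocity I γ b)) = o := expMap_neg_velocity hc o _ b
  have hpK : γ b ∈ K := hpb ▸ hKcl.frontier_subset hfb
  set s : ℝ := 1 - a / b with hs
  have hs0 : 0 < s := by
    have : a / b < 1 := (div_lt_one hb).2 hlt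
    rw [hs]; linarith
  have hs1 : s ≤ 1 := by
    have : 0 < a / b := div_pos ha hb
    rw [hs]; linarith
  have hint := expMap_smul_mem_interior hg hc hsec hK hpK (w := -(b • velocity I γ b))
    (by rw [hwo]; exact ho) hs0 hs1
  rw [hγ, expMap_neg_smul_velocity hc o _ b s,
    show b * (1 - s) = a by rw [hs]; field_simp; ring] at hint
  exact hfa.2 hint

omit [SimplyConnectedSpace M] [LocallyPathConnectedSpace M] [IsManifold I ∞ M]
  [FiniteDimensional ℝ E] [CompleteSpace E] [T2Space M] [I.Boundaryless] [g.HasLeviCivita]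
  [CovariantDerivative.ContMDiffCovariantDerivative g.leviCivita 1]
  [CovariantDerivative.ContMDiffCovariantDerivative g.leviCivita ∞] in
/-- First-order expansion of a map into a vector space along a chart line: if `G : N → E` has
`mfderiv` `L` at `x`, then `τ⁻¹ • G(φ⁻¹(φ x + τ ξ)) → L ξ` as `τ → 0`, `τ ≠ 0`, where `φ` is the
extended chart at `x` (and `G x = 0`). [folklore] -/
theorem tendsto_smul_comp_extChartAt_symm {E' : Type*} [NormedAddCommGroup E'] [NormedSpace ℝ E']
    {H' : Type*} [TopologicalSpace H'] {J : ModelWithCorners ℝ E' H'} [J.Boundaryless]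
    {N : Type*} [TopologicalSpace N] [ChartedSpace H' N] {G : N → E} {x : N}
    (hG : MDifferentiableAt J 𝓘(ℝ, E) G x) (hGx : G x = 0) (ξ : E') :
    Tendsto (fun τ : ℝ ↦ τ⁻¹ • G ((extChartAt J x).symm (extChartAt J x x + τ • ξ)))
      (𝓝[≠] 0) (𝓝 (mfderiv J 𝓘(ℝ, E) G x ξ)) := by
  have h1 := hG.hasMFDerivAt
  have h2 := h1.2
  rw [writtenInExtChartAt, extChartAt_model_space_eq_id, ModelWithCorners.Boundaryless.range_eq_univ,
    hasFDerivWithinAt_univ] at h2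
  -- `h2 : HasFDerivAt (id ∘ G ∘ φ.symm) L (φ x)`
  set φ := extChartAt J x with hφ
  have hline : HasDerivAt (fun τ : ℝ ↦ φ x + τ • ξ) ξ 0 := by
    simpa using ((hasDerivAt_id (0 : ℝ)).smul_const ξ).const_add (φ x)
  have h3 : HasFDerivAt (PartialEquiv.refl E ∘ G ∘ φ.symm) (mfderiv J 𝓘(ℝ, E) G x)
      (φ x + (0 : ℝ) • ξ) := by simpa using h2
  have h4 := h3.comp_hasDerivAt (0 : ℝ) hline
  rw [hasDerivAt_iff_tendsto_slope] at h4
  refine h4.congr' (eventually_nhdsWithin_of_forall fun τ _ ↦ ?_)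
  simp only [slope_def_module, sub_zero, Function.comp_apply, PartialEquiv.refl_coe, id_eq,
    zero_smul, add_zero]
  rw [PartialEquiv.left_inv _ (mem_extChartAt_source x), hGx, sub_zero]

/-- **Transversality of the frontier of a convex body to geodesic chords into its interior.**
Let `K` be convex (betweenness form), `j : N → M` a map differentiable at `x` with values off
`interior K` and `j x ∈ K`. Then no `w ∈ T_{j x}M` with `exp_{j x} w ∈ interior K` is tangent to
`j` at `x`, i.e. `w ∉ range d j_x`. Proof: in the normal chart `exp_{j x}⁻¹` (a global
diffeomorphism, Cartan–Hadamard) the points `j(φ⁻¹(φ x + τ ξ))` have coordinates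
`τ (w + o(1))`, hence lie in the open cone over a neighbourhood of `w` aimed at `interior K`, which
`expMap_smul_mem_interior` places inside `interior K` — contradiction.
[cite: Lee2018, Prop. 12.9] -/
theorem not_mem_range_mfderiv_of_expMap_mem_interior (hg : g.IsRiemannian)
    (hc : IsGeodesicallyComplete g.leviCivita)
    (hsec : ∀ (x : M) (X Y : TangentSpace I x), g.curvatureForm g.leviCivita x X Y Y X ≤ 0)
    {K : Set M}
    (hK : ∀ a ∈ K, ∀ b ∈ K, ∀ m : M, g.edist hg a m + g.edist hg m b = g.edist hg a b → m ∈ K)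
    {E' : Type*} [NormedAddCommGroup E'] [NormedSpace ℝ E'] {H' : Type*} [TopologicalSpace H']
    {J : ModelWithCorners ℝ E' H'} [J.Boundaryless] {N : Type*} [TopologicalSpace N]
    [ChartedSpace H' N] {j : N → M} {x : N} (hj : MDifferentiableAt J I j x)
    (hjK : ∀ y, j y ∉ interior K) (hx : j x ∈ K) {w : E}
    (hw : expMap g.leviCivita (j x) (show TangentSpace I (j x) from w) ∈ interior K) :
    w ∉ range (mfderiv J I j x) := by
  rintro ⟨ξ', hξ'⟩
  obtain ⟨ξ, hξ⟩ : ∃ ξ : E', mfderiv J I j x ξ = w := ⟨ξ', hξ'⟩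
  clear ξ' hξ'
  set p := j x with hp
  obtain ⟨Φ, hΦ⟩ := exists_expDiffeomorph hg hc hsec p
  set F : E → M := fun u ↦ expMap g.leviCivita p (show TangentSpace I p from u) with hFdef
  have hΦF : ∀ u, Φ u = F u := fun u ↦ congr_fun hΦ u
  have hF0 : F 0 = p := expMap_zero (cov := g.leviCivita) p
  have hΨp : Φ.symm p = 0 := by
    rw [← hF0, ← hΦF]; exact Φ.symm_apply_apply 0
  -- `G = Φ⁻¹ ∘ j`, with `G x = 0` and `dG_x ξ = w`
  set G : N → E := Φ.symm ∘ j with hG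
  have hΨd : MDifferentiableAt I 𝓘(ℝ, E) Φ.symm p :=
    Φ.symm.contMDiff.mdifferentiableAt (by simp)
  have hGd : MDifferentiableAt J 𝓘(ℝ, E) G x := hΨd.comp x hj
  have hGx : G x = 0 := hΨp
  -- `d(Φ⁻¹)_p = id` since `d(exp_p)_0 = id`
  have hdΨ : ∀ u : E, mfderiv I 𝓘(ℝ, E) Φ.symm p u = u := by
    intro u
    have hΦd : MDifferentiableAt 𝓘(ℝ, E) I Φ (Φ.symm p) := Φ.contMDiff.mdifferentiableAt (by simp)
    have h0 : mfderiv 𝓘(ℝ, E) I Φ (Φ.symm p) = ContinuousLinearMap.id ℝ E := by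
      rw [hΨp, hΦ]
      exact (hasMFDerivAt_expMap_zero (I := I) hc p).mfderiv
    have hcomp := mfderiv_comp p hΦd hΨd
    have hid : (Φ : E → M) ∘ Φ.symm = id := funext fun q ↦ Φ.apply_symm_apply q
    rw [hid, mfderiv_id, h0] at hcomp
    have h1 := congrArg (fun f ↦ f u) hcomp
    exact h1.symm
  have hdG : mfderiv J 𝓘(ℝ, E) G x ξ = w := by
    rw [hG, mfderiv_comp x hΨd hj]
    change mfderiv I 𝓘(ℝ, E) Φ.symm (j x) (mfderiv J I j x ξ) = w
    rw [hξ]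
    exact hdΨ w
  -- the first-order expansion along the chart line through `x` in direction `ξ`
  have hT := tendsto_smul_comp_extChartAt_symm hGd hGx ξ
  rw [hdG] at hT
  set U : Set E := F ⁻¹' interior K with hU
  have hUo : IsOpen U := isOpen_interior.preimage (hΦ ▸ Φ.continuous)
  have hwU : w ∈ U := hw
  have hev1 := (hT.mono_left (nhdsWithin_mono _ fun τ (hτ : τ ∈ Ioi (0 : ℝ)) ↦ ne_of_gt hτ)).eventually
    (hUo.mem_nhds hwU)
  have hev2 : ∀ᶠ τ in 𝓝[>] (0 : ℝ), τ ∈ Ioo (0 : ℝ) 1 := Ioo_mem_nhdsGT one_pos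
  obtain ⟨τ, hτU, hτ0, hτ1⟩ := (hev1.and hev2).exists
  set y : N := (extChartAt J x).symm (extChartAt J x x + τ • ξ) with hy
  have hint := expMap_smul_mem_interior hg hc hsec hK hx (w := τ⁻¹ • G y) hτU hτ0 hτ1.le
  have hint' : F (τ • τ⁻¹ • G y) ∈ interior K := hint
  rw [smul_smul, mul_inv_cancel₀ hτ0.ne', one_smul, ← hΦF] at hint'
  simp only [Function.comp_apply, Diffeomorph.apply_symm_apply] at hint'
  exact hjK y hint'

end Summit.SmoothPoincare4.SmoothPoincare4.Theorems.HadamardConvex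

end
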